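import Summits.ABC.IUTFork.Repair.RHHullCapacityNecessaryTyped
import Summits.ABC.IUTFork.Repair.RHTameBandLicence
import Summits.ABC.IUTFork.Cor312GenuineKDeepPlace
import Literature.NumberTheory.DiophantineGeometry.MinimalDiscriminantFiniteProofs
import HarnessLib

/-!
# D-0079 RESCUE sub-cell R-H, ROUND 2 Q3 «is a genuine datum always in Σ_row for l ≫ 0?» — the l-TAIL of the threshold rows
# 3 «hull-capacity-necessary», 4 «hull-threshold-exact», 5 «tame-band-licence» as KERNEL statements (seat abc-iut-rh2-q3-typ-1 g0)

abc-iut cell, rung LADDER-ABC:A2.RESCUE.H (`plan/rescue/R-H/ROUND2/START-HERE.md` v1.0 §1 Q3; charge director-abc g3 2026-08-26T19:46:32Z (10):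
«type '∃ l₀, ∀ l ≥ l₀, every genuine admissible datum lies in Σ_row' per kept row as kernel targets; rows 3/4/5 first — prove or refute»).
TAKES NO SIDE on [IUTchIII] Cor. 3.12 or on any author; nothing here asserts abc; the rows' H⋆'s are HYPOTHESES about OUR typed objects, consumed
BY NAME (`RHHullCapacityNecessaryTyped.HStar` p458118, `RH.HullThresholdExact.HullCell` p458452, `RH.TameBandLicence.HStarTameBandLicence` p458742).

READING OF «l ≫ 0». A genuine datum is a [IUTchI] Def. 3.1 initial Θ-datum `D : InitialThetaData F K Fbar E l Pb`; `l` and `K = F(E_F[l])` are PART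
of it, so the l-tail of «a datum» is: the same curve side `(F, E_F)`, ANY Def. 3.1 datum of level `l` over it. l-AXIS INVARIANTS already in the tree
at `Cor312Prov.pilotDataOfK D K`: (a) `l ∣ e(w|v)` at bad `w | v` (`ThetaData.l_dvd_ramificationIdx_of_under_mem_VFbad`), so `e_w = e(v|p)·e(w|v) ≥ l`
GROWS; (b) `2l·P_q(w) = e(w|v)·ord_v(q_v)` (`Cor312Prov.exists_nat_qPilot_pilotDataOfK`), so a cell's DEMAND at label `j ≤ l⋆` is
`(j−1)·P_q(w)/e_w ≤ ((l−3)/(4l))·H_v < H_v/4`, `H_v := ord_v(q_v)/e(v|p)` l-FREE; (c) every threshold CAPACITY contains the [IUTchIV] Prop. 1.2 upper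
radius `b_e = ⌊log_p(pe/(p−1))⌋ − 1/e ≥ log_p l − 1`. So PER CURVE every threshold cell is eventually met, with `l₀` EXPONENTIAL in the local heights.

RESULTS. §0 `logRadiusB_ge_of_pow_le`, `depth_constants_ge` (`p^t ≤ e ⟹ t + 1 ≤ d + a + b + c`). §1 ROW 3: `cellAt_of_linear` /
`not_cellAt_of_linear` (the [ED] cell is SANDWICHED by the linear tests `(j−1)μ ≤ d+a+b+c` / `≥ d+a+b+c+1`); `cellAt_pilotDataOfK_of_ltail`
(`p^t ≤ l ∧ ord_v(q_v) ≤ 4e(v|p)(t+1) ⟹ CellAt` at every label); `hStar_pilotDataOfK_of_pow_le`; TARGET `LTailSigma3 F E` («∃ l₀(E) ∀ l ≥ l₀ ∀ data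
of level l over (F,E): H⋆₃») PROVED (`lTailSigma3_holds`, `l₀ = max_{v∣Δ_min} p_v^{ord_v Δ_min}`, Silverman VIII.8 finiteness) ⇒ Q3(row 3) = YES per
curve. §2 ROW 5: `not_tame_of_ltail` (no bad place with `p ≤ l+1` is tame: `e_w ≥ l`), `hStarTameBandLicence_of_ltail`, TARGET `LTailSigma5 F E` PROVED
VACUOUSLY (`l₀ = max p_v`) ⇒ Q3(row 5) = YES-VACUOUS (the tame scope empties; the row is silent on the tail). ROW 4 (`RH.HullThresholdExact.HullCell`): companion file
`RHQ3LTailHull` (no NEG-certificate and no POS-certificate in the tail: the certified column is constantly OPEN; the exact cell follows the true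
outer radius `r_out(K_w) ≤ p^t − t·e_w`, R-W lane U) ⇒ Q3(row 4) = CONDITIONAL. THE UNIFORM READING (one `l₀` for ALL curves) is false in substance (`not_cellAt_of_linear` + HEX `k ≥ 13` refuted at every
prime `l ≤ 3361`, `HexLocalType.not_pilotKummerCompatHull_lamSeven_thirty`) but a kernel `¬` needs admissible data of unbounded local height at fixed `l`.
WINDOW: (C1) of `Cor22.partII_of_thm110Legendre` has `√h ≤ l ≤ 10δ√h·log(2δh)`, while `l₀(E) ≍ max_v p_v^{H_v/4}` is exponential in the height carried
by one place — inside (C1) only data with `H_v ≲ 4(log_p e_w + 3)` at every bad `v` can lie in Σ₃/Σ₄ (numerics: rh2-q3-num).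
[cite: Mochizuki2012, IUTchI Def. 3.1 (b)(c) pp. 61–62, Ex. 3.2 (iv) p. 71; IUTchIV Prop. 1.1 p. 9, Prop. 1.2 (i)(ii) p. 10, Cor. 2.2 (ii) p. 45]
[cite: DupuyHilado2025, §3.3, §3.4, §4.9] [cite: SilvermanAEC2009, VII.5 Prop. 5.1(b), VIII.8] [claim: Mochizuki2012, status: disputed] for every IUT locution.
-/

noncomputable section

open Set Function NumberField IsDedekindDomain
open scoped Pointwise

namespace Summit.ABC.IUTFork.Repair.RH.Q3LTail

open Literature.AnabelianGeometry.AbsoluteAnabelian Literature.IUT.LogThetaLattice Literature.IUT.LogVolume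
  Literature.IUT.HodgeTheaters Literature.NumberTheory.NumberFields Literature.NumberTheory.GaloisRepresentations.Ultrametric
open Summit.ABC.IUTFork.Thm311 Summit.ABC.IUTFork.Thm311.Real Summit.ABC.IUTFork.Cor312 Summit.ABC.IUTFork.Cor312.Setting
  Summit.ABC.IUTFork.Cor312Vol Summit.ABC.IUTFork.Cor312Vol.ExplicitDepth Summit.ABC.IUTFork.Cor312Prov
  Summit.ABC.IUTFork.Repair.RHHullCapacityNecessaryTyped Summit.ABC.IUTFork.Repair.RH.TameBandLicence

/-! ## §0. The [IUTchIV] Prop. 1.2 upper radius grows like `log_p e` -/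

/-- **`p^t ≤ e ⟹ t − 1/e ≤ b_e`** for `b_e = ⌊log(p·e/(p−1))/log p⌋ − 1/e` ([IUTchIV] Prop. 1.2): `p^t ≤ e ≤ p·e/(p−1)`, take `log_p` and floors.
The upper log-shell radius is UNBOUNDED along `e → ∞` — the l-axis mechanism of this file. [cite: Mochizuki2012, IUTchIV Prop. 1.2 p. 10] -/
theorem logRadiusB_ge_of_pow_le {p e t : ℕ} (hp : 2 ≤ p) (he : 1 ≤ e) (ht : p ^ t ≤ e) :
    (t : ℝ) - 1 / e ≤ logRadiusB p e := by
  unfold logRadiusB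
  have hpR : (2 : ℝ) ≤ p := by exact_mod_cast hp
  have hp1 : (0 : ℝ) < (p : ℝ) - 1 := by linarith
  have hlogp : 0 < Real.log p := Real.log_pos (by linarith)
  have heR : (1 : ℝ) ≤ e := by exact_mod_cast he
  have hpt : ((p : ℝ)) ^ t ≤ e := by exact_mod_cast ht
  have hq : (p : ℝ) ^ t ≤ (p : ℝ) * e / ((p : ℝ) - 1) := by
    rw [le_div_iff₀ hp1]
    nlinarith
  have hfloor : (t : ℤ) ≤ ⌊Real.log ((p : ℝ) * e / ((p : ℝ) - 1)) / Real.log p⌋ := by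
    rw [Int.le_floor, Int.cast_natCast, le_div_iff₀ hlogp, ← Real.log_pow]
    exact Real.log_le_log (by positivity) hq
  have h : (t : ℝ) ≤ (⌊Real.log ((p : ℝ) * e / ((p : ℝ) - 1)) / Real.log p⌋ : ℝ) := by exact_mod_cast hfloor
  linarith

/-- **`p^t ≤ e(K₀/ℚ_p) ⟹ t + 1 ≤ d + a + b + c`** for the [IUTchIV] Prop. 1.1/1.2 constants of ANY `p`-adic field `K₀` (`d ≥ 0`, `a ≥ 1/e`,
`b ≥ t − 1/e`, `c = ord_p(2p) ≥ 1`): the CAPACITY side of every threshold row is at least `log_p e` per slot. [cite: Mochizuki2012, IUTchIV Prop. 1.1 p. 9, Prop. 1.2 p. 10] -/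
theorem depth_constants_ge (p : ℕ) [hp : Fact p.Prime] (K₀ : Type) [NontriviallyNormedField K₀] [NormedAlgebra ℚ_[p] K₀]
    [IsUltrametricDist K₀] [ProperSpace K₀] {t : ℕ} (ht : p ^ t ≤ absRamificationIdx p K₀) :
    (t : ℝ) + 1 ≤ differentOrd p K₀ + logRadiusA p (absRamificationIdx p K₀) + logRadiusB p (absRamificationIdx p K₀)
      + (((if p = 2 then 2 else 1 : ℕ)) : ℝ) := by
  have he : 1 ≤ absRamificationIdx p K₀ := absRamificationIdx_pos p K₀
  have hd : 0 ≤ differentOrd p K₀ := differentOrd_nonneg p K₀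
  have ha : 1 / (absRamificationIdx p K₀ : ℝ) ≤ logRadiusA p (absRamificationIdx p K₀) := one_div_le_logRadiusA hp.out he
  have hb : (t : ℝ) - 1 / (absRamificationIdx p K₀ : ℝ) ≤ logRadiusB p (absRamificationIdx p K₀) :=
    logRadiusB_ge_of_pow_le hp.out.two_le he ht
  have hc : (1 : ℝ) ≤ (((if p = 2 then 2 else 1 : ℕ)) : ℝ) := by split_ifs <;> norm_num
  linarith

/-! ## §1. ROW 3 «hull-capacity-necessary»: the l-tail is INSIDE Σ₃, per curve, with `l₀` exponential in the local heights -/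

section Row3Generic

variable {F : Type} [Field F] [NumberField F] (X : PilotData F) {logv : PadicLogs F} (hlog : LogvAnalytic logv)

/-- **LINEAR SUFFICIENT TEST for H⋆₃'s cell**: `(j−1)·μ ≤ d + a + b + c ⟹ CellAt` (`j = i₀+1`; drop the floor in `cellAt_iff_floor_le` and divide
`(j²−1)·μ ≤ (j+1)·(d+a+b+c)` by `j+1`). [cite: Mochizuki2012, IUTchIV Prop. 1.2 (i)(ii) p. 10] [claim: Mochizuki2012, status: disputed] -/
theorem cellAt_of_linear (pp : Nat.Primes) (i₀ : Fin (thetaIndex X).lstar) (x₀ : (thetaIndex X).Fibre (.inr pp))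
    (h : haveI : Fact (pp : ℕ).Prime := ⟨pp.2⟩
      ((i₀ : ℕ) : ℝ) * (X.qPilot (placeOf X pp.1 x₀) / (ramIdx F (placeOf X pp.1 x₀) : ℝ)) ≤
        differentOrd (pp : ℕ) (kOf X pp.1 x₀) + logRadiusA (pp : ℕ) (absRamificationIdx (pp : ℕ) (kOf X pp.1 x₀))
          + logRadiusB (pp : ℕ) (absRamificationIdx (pp : ℕ) (kOf X pp.1 x₀)) + (((if (pp : ℕ) = 2 then 2 else 1 : ℕ)) : ℝ)) :
    CellAt X hlog pp i₀ x₀ := by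
  haveI hF : Fact (pp : ℕ).Prime := ⟨pp.2⟩
  rw [cellAt_iff_floor_le]
  set μ : ℝ := X.qPilot (placeOf X pp.1 x₀) / (ramIdx F (placeOf X pp.1 x₀) : ℝ)
  set d : ℝ := differentOrd (pp : ℕ) (kOf X pp.1 x₀)
  set a : ℝ := logRadiusA (pp : ℕ) (absRamificationIdx (pp : ℕ) (kOf X pp.1 x₀))
  set b : ℝ := logRadiusB (pp : ℕ) (absRamificationIdx (pp : ℕ) (kOf X pp.1 x₀))
  set c : ℝ := (((if (pp : ℕ) = 2 then 2 else 1 : ℕ)) : ℝ)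
  have hfl := Int.floor_le ((((i₀ : ℕ) + 1 : ℕ) : ℝ) ^ 2 * μ - ((i₀ : ℕ) + 2 : ℝ) * (d + a))
  have hsq : (((i₀ : ℕ) + 1 : ℕ) : ℝ) ^ 2 = ((i₀ : ℕ) : ℝ) * ((i₀ : ℕ) + 2 : ℝ) + 1 := by push_cast; ring
  have hi0 : (0 : ℝ) ≤ (i₀ : ℕ) := Nat.cast_nonneg _
  have hmul : ((i₀ : ℕ) + 2 : ℝ) * (((i₀ : ℕ) : ℝ) * μ) ≤ ((i₀ : ℕ) + 2 : ℝ) * (d + a + b + c) :=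
    mul_le_mul_of_nonneg_left h (by linarith)
  rw [hsq] at hfl ⊢
  nlinarith [hfl, hmul]

/-- **LINEAR REFUTING TEST for H⋆₃'s cell**: `d + a + b + c + 1 ≤ (j−1)·μ ⟹ ¬CellAt` (`⌊x⌋ > x − 1`). Together with `cellAt_of_linear`
the cell is SANDWICHED between two linear tests one unit apart: `l₀` below is sharp up to that unit. [cite: Mochizuki2012, IUTchIV Prop. 1.2 (i)(ii) p. 10]
[claim: Mochizuki2012, status: disputed] -/
theorem not_cellAt_of_linear (pp : Nat.Primes) (i₀ : Fin (thetaIndex X).lstar) (x₀ : (thetaIndex X).Fibre (.inr pp))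
    (h : haveI : Fact (pp : ℕ).Prime := ⟨pp.2⟩
      differentOrd (pp : ℕ) (kOf X pp.1 x₀) + logRadiusA (pp : ℕ) (absRamificationIdx (pp : ℕ) (kOf X pp.1 x₀))
          + logRadiusB (pp : ℕ) (absRamificationIdx (pp : ℕ) (kOf X pp.1 x₀)) + (((if (pp : ℕ) = 2 then 2 else 1 : ℕ)) : ℝ) + 1 ≤
        ((i₀ : ℕ) : ℝ) * (X.qPilot (placeOf X pp.1 x₀) / (ramIdx F (placeOf X pp.1 x₀) : ℝ))) :
    ¬ CellAt X hlog pp i₀ x₀ := by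
  haveI hF : Fact (pp : ℕ).Prime := ⟨pp.2⟩
  rw [cellAt_iff_floor_le, not_le]
  set μ : ℝ := X.qPilot (placeOf X pp.1 x₀) / (ramIdx F (placeOf X pp.1 x₀) : ℝ)
  set d : ℝ := differentOrd (pp : ℕ) (kOf X pp.1 x₀)
  set a : ℝ := logRadiusA (pp : ℕ) (absRamificationIdx (pp : ℕ) (kOf X pp.1 x₀))
  set b : ℝ := logRadiusB (pp : ℕ) (absRamificationIdx (pp : ℕ) (kOf X pp.1 x₀))
  set c : ℝ := (((if (pp : ℕ) = 2 then 2 else 1 : ℕ)) : ℝ)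
  have hfl := Int.lt_floor_add_one ((((i₀ : ℕ) + 1 : ℕ) : ℝ) ^ 2 * μ - ((i₀ : ℕ) + 2 : ℝ) * (d + a))
  have hsq : (((i₀ : ℕ) + 1 : ℕ) : ℝ) ^ 2 = ((i₀ : ℕ) : ℝ) * ((i₀ : ℕ) + 2 : ℝ) + 1 := by push_cast; ring
  have hi0 : (0 : ℝ) ≤ (i₀ : ℕ) := Nat.cast_nonneg _
  have hmul : ((i₀ : ℕ) + 2 : ℝ) * (d + a + b + c + 1) ≤ ((i₀ : ℕ) + 2 : ℝ) * (((i₀ : ℕ) : ℝ) * μ) :=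
    mul_le_mul_of_nonneg_left h (by linarith)
  rw [hsq] at hfl ⊢
  nlinarith [hfl, hmul]

end Row3Generic

section Row3Genuine

variable {F K Fbar : Type} [Field F] [NumberField F] [Field K] [NumberField K] [Algebra F K] [Field Fbar]
  [Algebra F Fbar] [Algebra K Fbar] {E : WeierstrassCurve F} [E.IsElliptic] {l : ℕ} {Pb : BadPlacePredicates K}
  (D : InitialThetaData F K Fbar E l Pb) {logv : PadicLogs K} (hlog : LogvAnalytic logv)

/-- **Label bound at the genuine datum**: every label index satisfies `2·i₀ + 3 ≤ l` (`i₀ < l⋆ = (l−1)/2`). [cite: Mochizuki2012, IUTchI Def. 3.1 (c) p. 61] -/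
theorem two_mul_label_add_three_le (i₀ : Fin (thetaIndex (pilotDataOfK D K)).lstar) : 2 * (i₀ : ℕ) + 3 ≤ l := by
  have hi : (i₀ : ℕ) < (pilotDataOfK D K).lstar := i₀.2
  have hls : (pilotDataOfK D K).lstar = (l - 1) / 2 := by
    unfold PilotData.lstar
    rw [pilotDataOfK_l]
  omega

/-- **ROW 3, GENUINE CELL IN THE l-TAIL.** At a bad place `w | p` of the `K`-level pilot datum of a Def. 3.1 datum `D` over `v = w ∩ F`: if
`p^t ≤ l` and `ord_v(q_v) ≤ 4·e(v|p)·(t+1)`, then H⋆₃'s cell holds at EVERY label. Mechanism: `e_w = e(v|p)·e(w|v) ≥ l ≥ p^t` so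
`d + a + b + c ≥ t + 1` (`depth_constants_ge`), while `(j−1)·μ = i₀·ord_v(q_v)/(2l·e(v|p)) ≤ ((l−3)/2)·4(t+1)/(2l) < t + 1`.
[cite: Mochizuki2012, IUTchI Def. 3.1 (c) p. 62, Ex. 3.2 (iv) p. 71; IUTchIV Prop. 1.2 (i)(ii) p. 10] [claim: Mochizuki2012, status: disputed] -/
theorem cellAt_pilotDataOfK_of_ltail (pp : Nat.Primes) (i₀ : Fin (thetaIndex (pilotDataOfK D K)).lstar)
    (w : (thetaIndex (pilotDataOfK D K)).Fibre (.inr pp))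
    (hw : haveI : Fact (pp : ℕ).Prime := ⟨pp.2⟩; placeOf (pilotDataOfK D K) pp.1 w ∈ (pilotDataOfK D K).S)
    (t : ℕ) (hpt : (pp : ℕ) ^ t ≤ l)
    (hn : haveI : Fact (pp : ℕ).Prime := ⟨pp.2⟩
      qParamOrd E (finBelow F K (placeOf (pilotDataOfK D K) pp.1 w)) ≤
        4 * ramIdx F (finBelow F K (placeOf (pilotDataOfK D K) pp.1 w)) * (t + 1)) :
    CellAt (pilotDataOfK D K) hlog pp i₀ w := by
  haveI hF : Fact (pp : ℕ).Prime := ⟨pp.2⟩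
  set w₀ := placeOf (pilotDataOfK D K) pp.1 w with hw₀
  set v := finBelow F K w₀ with hv
  obtain ⟨P, hP, -, h2lP⟩ := exists_nat_qPilot_pilotDataOfK D hw
  -- tower `e(w|p) = e(v|p)·e(w|v)` and `l ≤ e(w|v)`
  have htower : w₀.asIdeal.ramificationIdx ℤ = ramIdx F v * Ideal.ramificationIdx' v.asIdeal w₀.asIdeal :=
    ThetaData.absRamificationIdx_eq_ramIdx_mul (F := F) w₀
  have hVF : FinitePlace.mk v ∈ D.VFbad := (mem_pilotDataOfK_S_iff D K w₀).mp hw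
  have hlr : l ≤ Ideal.ramificationIdx' v.asIdeal w₀.asIdeal := ThetaData.l_le_ramificationIdx_of_under_mem_VFbad D hVF
  have he0 : 0 < ramIdx F v := Nat.pos_of_ne_zero (ramIdx_ne_zero F v)
  have heK : absRamificationIdx (pp : ℕ) (kOf (pilotDataOfK D K) pp.1 w) = w₀.asIdeal.ramificationIdx ℤ :=
    absRamificationIdx_rescaledCompletion K (pp : ℕ) w₀ (natCast_mem_placeOf (pilotDataOfK D K) pp.1 w)
  have hpte : (pp : ℕ) ^ t ≤ absRamificationIdx (pp : ℕ) (kOf (pilotDataOfK D K) pp.1 w) := by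
    rw [heK, htower]
    calc (pp : ℕ) ^ t ≤ l := hpt
      _ ≤ Ideal.ramificationIdx' v.asIdeal w₀.asIdeal := hlr
      _ ≤ ramIdx F v * Ideal.ramificationIdx' v.asIdeal w₀.asIdeal := Nat.le_mul_of_pos_left _ he0
  have hconst := depth_constants_ge (pp : ℕ) (kOf (pilotDataOfK D K) pp.1 w) hpte
  have hi := two_mul_label_add_three_le D i₀
  -- the key integer inequality `i₀·P ≤ (t+1)·e(w|p)`
  have hkey : (i₀ : ℕ) * P ≤ (t + 1) * w₀.asIdeal.ramificationIdx ℤ := by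
    have hl0 : 0 < 2 * l := by omega
    refine Nat.le_of_mul_le_mul_left ?_ hl0
    rw [htower]
    calc 2 * l * ((i₀ : ℕ) * P) = (i₀ : ℕ) * (2 * l * P) := by ring
      _ = (i₀ : ℕ) * (Ideal.ramificationIdx' v.asIdeal w₀.asIdeal * qParamOrd E v) := by rw [h2lP]
      _ ≤ (i₀ : ℕ) * (Ideal.ramificationIdx' v.asIdeal w₀.asIdeal * (4 * ramIdx F v * (t + 1))) := by gcongr
      _ = (4 * (i₀ : ℕ)) * (ramIdx F v * Ideal.ramificationIdx' v.asIdeal w₀.asIdeal * (t + 1)) := by ring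
      _ ≤ (2 * l) * (ramIdx F v * Ideal.ramificationIdx' v.asIdeal w₀.asIdeal * (t + 1)) :=
          Nat.mul_le_mul_right _ (by omega)
      _ = 2 * l * ((t + 1) * (ramIdx F v * Ideal.ramificationIdx' v.asIdeal w₀.asIdeal)) := by ring
  apply cellAt_of_linear
  have heZpos : (0 : ℝ) < (w₀.asIdeal.ramificationIdx ℤ : ℝ) := by
    have : 0 < w₀.asIdeal.ramificationIdx ℤ := by
      rw [htower]; exact Nat.mul_pos he0 (lt_of_lt_of_le (by omega) hlr)
    exact_mod_cast this
  have hkeyR : ((i₀ : ℕ) : ℝ) * (P : ℝ) ≤ ((t : ℝ) + 1) * (w₀.asIdeal.ramificationIdx ℤ : ℝ) := by exact_mod_cast hkey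
  rw [hP, ramIdx_eq K w₀]
  calc ((i₀ : ℕ) : ℝ) * ((P : ℝ) / (w₀.asIdeal.ramificationIdx ℤ : ℝ))
      = ((i₀ : ℕ) : ℝ) * (P : ℝ) / (w₀.asIdeal.ramificationIdx ℤ : ℝ) := by ring
    _ ≤ ((t : ℝ) + 1) * (w₀.asIdeal.ramificationIdx ℤ : ℝ) / (w₀.asIdeal.ramificationIdx ℤ : ℝ) := by gcongr
    _ = (t : ℝ) + 1 := by field_simp
    _ ≤ _ := hconst

/-- **ROW 3, DATUM FORM.** If at every bad place `w | p` (over `v`) some `t` has `p^t ≤ l` and `ord_v(q_v) ≤ 4·e(v|p)·(t+1)`, then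
`H⋆₃ (pilotDataOfK D K)` — the datum lies in Σ₃ (every cell not [ED]-refutable). [claim: Mochizuki2012, status: disputed] -/
theorem hStar_pilotDataOfK_of_ltail
    (h : ∀ (pp : Nat.Primes) (w : (thetaIndex (pilotDataOfK D K)).Fibre (.inr pp)),
      haveI : Fact (pp : ℕ).Prime := ⟨pp.2⟩
      placeOf (pilotDataOfK D K) pp.1 w ∈ (pilotDataOfK D K).S →
        ∃ t : ℕ, (pp : ℕ) ^ t ≤ l ∧
          qParamOrd E (finBelow F K (placeOf (pilotDataOfK D K) pp.1 w)) ≤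
            4 * ramIdx F (finBelow F K (placeOf (pilotDataOfK D K) pp.1 w)) * (t + 1)) :
    HStar (pilotDataOfK D K) hlog := by
  intro pp w hw i₀
  obtain ⟨t, hpt, hn⟩ := h pp w hw
  exact cellAt_pilotDataOfK_of_ltail D hlog pp i₀ w hw t hpt hn

/-- **ROW 3, CRUDE CLOSED FORM**: `p^{ord_v(q_v)} ≤ l` at every bad place ⟹ `H⋆₃` (take `t = ord_v(q_v)`; `n ≤ 4·e·(n+1)`).
[claim: Mochizuki2012, status: disputed] -/
theorem hStar_pilotDataOfK_of_pow_le
    (h : ∀ (pp : Nat.Primes) (w : (thetaIndex (pilotDataOfK D K)).Fibre (.inr pp)),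
      haveI : Fact (pp : ℕ).Prime := ⟨pp.2⟩
      placeOf (pilotDataOfK D K) pp.1 w ∈ (pilotDataOfK D K).S →
        (pp : ℕ) ^ qParamOrd E (finBelow F K (placeOf (pilotDataOfK D K) pp.1 w)) ≤ l) :
    HStar (pilotDataOfK D K) hlog := by
  refine hStar_pilotDataOfK_of_ltail D hlog fun pp w hw => ⟨_, h pp w hw, ?_⟩
  haveI : Fact (pp : ℕ).Prime := ⟨pp.2⟩
  have he : 1 ≤ ramIdx F (finBelow F K (placeOf (pilotDataOfK D K) pp.1 w)) :=
    Nat.one_le_iff_ne_zero.mpr (ramIdx_ne_zero F _)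
  nlinarith [he, Nat.zero_le (qParamOrd E (finBelow F K (placeOf (pilotDataOfK D K) pp.1 w)))]

end Row3Genuine

section Row3Target

variable (F : Type) [Field F] [NumberField F] (E : WeierstrassCurve F) [E.IsElliptic]

/-- **Q3 TARGET, ROW 3 (per-curve l-tail)** [R-H round 2, kernel target]: «∃ l₀(E), ∀ l ≥ l₀, EVERY [IUTchI] Def. 3.1 initial Θ-datum of level
`l` over `(F, E_F)` has its `K`-level pilot datum in Σ₃», i.e. H⋆₃ = `RHHullCapacityNecessaryTyped.HStar` holds for any analytic logarithm family.
The quantifier over `K, F̄, Pb, D` ranges over all data of level `l`; «admissible» side conditions only shrink the range. PROVED below (`lTailSigma3_holds`).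
[cite: Mochizuki2012, IUTchI Def. 3.1 pp. 61–63; IUTchIV Prop. 1.2 (i)(ii) p. 10] [claim: Mochizuki2012, status: disputed] -/
@[claim "Mochizuki2012" "disputed"]
def LTailSigma3 : Prop :=
  ∃ l₀ : ℕ, ∀ l : ℕ, l₀ ≤ l →
    ∀ (K Fbar : Type) [Field K] [NumberField K] [Algebra F K] [Field Fbar] [Algebra F Fbar] [Algebra K Fbar]
      (Pb : BadPlacePredicates K) (D : InitialThetaData F K Fbar E l Pb) (logv : PadicLogs K) (hlog : LogvAnalytic logv),
      HStar (pilotDataOfK D K) hlog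

/-- **Q3(row 3) = YES, per curve**: `LTailSigma3 F E` holds with `l₀ := max {p_v^{ord_v(Δ_min)} : ord_v(Δ_min) ≠ 0}` (a finite max: Silverman VIII.8,
`WeierstrassCurve.finite_setOf_ordMinimalDiscriminant_ne_zero_holds`; every bad place of a Def. 3.1 datum is multiplicative, VII.5.1(b)
`ordMinimalDiscriminant_ne_zero_of_hasMultiplicativeReductionAt`). This `l₀` is EXPONENTIAL in the local heights; the sharper per-place threshold is
`cellAt_pilotDataOfK_of_ltail`. [cite: SilvermanAEC2009, VII.5 Prop. 5.1(b), VIII.8] [claim: Mochizuki2012, status: disputed] -/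
theorem lTailSigma3_holds : LTailSigma3 F E := by
  classical
  have hfin : {v : HeightOneSpectrum (𝓞 F) | E.ordMinimalDiscriminant v ≠ 0}.Finite :=
    E.finite_setOf_ordMinimalDiscriminant_ne_zero_holds (A := 𝓞 F)
  refine ⟨hfin.toFinset.sup (fun v => residueChar F v ^ qParamOrd E v), fun l hl K Fbar _ _ _ _ _ _ Pb D logv hlog => ?_⟩
  refine hStar_pilotDataOfK_of_pow_le D hlog fun pp w hw => ?_
  haveI : Fact (pp : ℕ).Prime := ⟨pp.2⟩
  set v := finBelow F K (placeOf (pilotDataOfK D K) pp.1 w) with hv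
  have hVF : FinitePlace.mk v ∈ D.VFbad := (mem_pilotDataOfK_S_iff D K _).mp hw
  have hmult : E.HasMultiplicativeReductionAt v := ThetaData.hasMultiplicativeReductionAt_under_of_mem_VFbad D hVF
  have hne : E.ordMinimalDiscriminant v ≠ 0 := E.ordMinimalDiscriminant_ne_zero_of_hasMultiplicativeReductionAt v hmult
  have hvS : v ∈ hfin.toFinset := by
    rw [Set.Finite.mem_toFinset]
    exact hne
  have hres : residueChar F v = (pp : ℕ) := by
    rw [hv, residueChar_finBelow]
    exact residueChar_eq_of_natCast_mem (pp : ℕ) (natCast_mem_placeOf (pilotDataOfK D K) pp.1 w)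
  calc (pp : ℕ) ^ qParamOrd E v = residueChar F v ^ qParamOrd E v := by rw [hres]
    _ ≤ hfin.toFinset.sup (fun v => residueChar F v ^ qParamOrd E v) :=
        Finset.le_sup (f := fun v => residueChar F v ^ qParamOrd E v) hvS
    _ ≤ l := hl

end Row3Target

/-! ## §2. ROW 5 «tame-band-licence»: the tame scope EMPTIES in the l-tail (H⋆₅ vacuous) -/

section Row5

variable {F K Fbar : Type} [Field F] [NumberField F] [Field K] [NumberField K] [Algebra F K] [Field Fbar]
  [Algebra F Fbar] [Algebra K Fbar] {E : WeierstrassCurve F} [E.IsElliptic] {l : ℕ} {Pb : BadPlacePredicates K}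
  (D : InitialThetaData F K Fbar E l Pb)

/-- **No bad place with `p ≤ l + 1` is tame**: `e(w|p) ≥ l ≥ p − 1 > p − 2` (`Cor312Prov.l_le_ramificationIdx_int_of_over_VFbad`). Along the l-axis
of a fixed curve the tame stratum of row 5 is EMPTY from `l = max_v p_v − 1` on. [cite: Mochizuki2012, IUTchI Def. 3.1 (c) p. 62, Ex. 3.2 (iv) p. 71]
[claim: Mochizuki2012, status: disputed] -/
theorem not_tame_of_ltail (pp : Nat.Primes) (w : (thetaIndex (pilotDataOfK D K)).Fibre (.inr pp))
    (hw : haveI : Fact (pp : ℕ).Prime := ⟨pp.2⟩; placeOf (pilotDataOfK D K) pp.1 w ∈ (pilotDataOfK D K).S)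
    (hpl : (pp : ℕ) ≤ l + 1) :
    haveI : Fact (pp : ℕ).Prime := ⟨pp.2⟩
    ¬ (placeOf (pilotDataOfK D K) pp.1 w).asIdeal.ramificationIdx ℤ ≤ (pp : ℕ) - 2 := by
  haveI : Fact (pp : ℕ).Prime := ⟨pp.2⟩
  have hle := l_le_ramificationIdx_int_of_over_VFbad D (placeOf (pilotDataOfK D K) pp.1 w)
    ((mem_pilotDataOfK_S_iff D K _).mp hw)
  have h5 : 5 ≤ l := D.five_le_l
  omega

/-- **ROW 5 IN THE l-TAIL: H⋆₅ holds VACUOUSLY** once `p ≤ l + 1` at every bad prime (no tame bad packet is left to constrain).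
[claim: Mochizuki2012, status: disputed] -/
theorem hStarTameBandLicence_of_ltail
    (h : ∀ (pp : Nat.Primes) (w : (thetaIndex (pilotDataOfK D K)).Fibre (.inr pp)),
      haveI : Fact (pp : ℕ).Prime := ⟨pp.2⟩
      placeOf (pilotDataOfK D K) pp.1 w ∈ (pilotDataOfK D K).S → (pp : ℕ) ≤ l + 1) :
    HStarTameBandLicence D := by
  intro pp i w hw _ htame P _
  exact absurd htame (not_tame_of_ltail D pp w hw (h pp w hw))

end Row5

section Row5Target

variable (F : Type) [Field F] [NumberField F] (E : WeierstrassCurve F) [E.IsElliptic]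

/-- **Q3 TARGET, ROW 5 (per-curve l-tail)** [R-H round 2, kernel target]: «∃ l₀(E), ∀ l ≥ l₀, every Def. 3.1 datum of level `l` over `(F, E_F)`
satisfies H⋆₅ = `RH.TameBandLicence.HStarTameBandLicence`». PROVED below — VACUOUSLY: the row's tame scope is empty in the tail, so membership in Σ₅
carries no information about S_H there. [cite: Mochizuki2012, IUTchI Def. 3.1 pp. 61–63] [claim: Mochizuki2012, status: disputed] -/
@[claim "Mochizuki2012" "disputed"]
def LTailSigma5 : Prop :=
  ∃ l₀ : ℕ, ∀ l : ℕ, l₀ ≤ l →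
    ∀ (K Fbar : Type) [Field K] [NumberField K] [Algebra F K] [Field Fbar] [Algebra F Fbar] [Algebra K Fbar]
      (Pb : BadPlacePredicates K) (D : InitialThetaData F K Fbar E l Pb), HStarTameBandLicence D

/-- **Q3(row 5) = YES-VACUOUS, per curve**: `LTailSigma5 F E` with `l₀ := max {p_v : ord_v(Δ_min) ≠ 0}`.
[cite: SilvermanAEC2009, VII.5 Prop. 5.1(b), VIII.8] [claim: Mochizuki2012, status: disputed] -/
theorem lTailSigma5_holds : LTailSigma5 F E := by
  classical
  have hfin : {v : HeightOneSpectrum (𝓞 F) | E.ordMinimalDiscriminant v ≠ 0}.Finite :=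
    E.finite_setOf_ordMinimalDiscriminant_ne_zero_holds (A := 𝓞 F)
  refine ⟨hfin.toFinset.sup (fun v => residueChar F v), fun l hl K Fbar _ _ _ _ _ _ Pb D => ?_⟩
  refine hStarTameBandLicence_of_ltail D fun pp w hw => ?_
  haveI : Fact (pp : ℕ).Prime := ⟨pp.2⟩
  set v := finBelow F K (placeOf (pilotDataOfK D K) pp.1 w) with hv
  have hVF : FinitePlace.mk v ∈ D.VFbad := (mem_pilotDataOfK_S_iff D K _).mp hw
  have hmult : E.HasMultiplicativeReductionAt v := ThetaData.hasMultiplicativeReductionAt_under_of_mem_VFbad D hVF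
  have hne : E.ordMinimalDiscriminant v ≠ 0 := E.ordMinimalDiscriminant_ne_zero_of_hasMultiplicativeReductionAt v hmult
  have hvS : v ∈ hfin.toFinset := by
    rw [Set.Finite.mem_toFinset]
    exact hne
  have hres : residueChar F v = (pp : ℕ) := by
    rw [hv, residueChar_finBelow]
    exact residueChar_eq_of_natCast_mem (pp : ℕ) (natCast_mem_placeOf (pilotDataOfK D K) pp.1 w)
  calc (pp : ℕ) = residueChar F v := hres.symm
    _ ≤ hfin.toFinset.sup (fun v => residueChar F v) := Finset.le_sup (f := fun v => residueChar F v) hvS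
    _ ≤ l := hl
    _ ≤ l + 1 := Nat.le_succ l

end Row5Target

end Summit.ABC.IUTFork.Repair.RH.Q3LTail

end
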